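import Summits.CriticalPhenomena.SAWScalingLimit.Theorems.SAWLeftRightFKGFKGToTraversalBoundNecklaceHung
import HarnessLib

/-!
# Slit necklace, STUB 2: the HUNG presentation for an arbitrary target

Crux `SAWLeftRightFKG.FKGToTraversalBound` (stmt-CriticalPhenomena-1878), line `slit-necklace`,
registered stub `stub_hungPresentation` (skeleton `Lines/slit_necklace.lean`, STUB 2): **every hung
carrier is r2.**

`C : c → c` is a closed lattice walk, `Ω = dom C δ = {wind ≠ 0}` its r2 carrier, `K ∌ b` a finite set
of sites ATTACHED to `C` (every `k ∈ K` is joined to a vertex of `C` by a lattice walk through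
`K ∪ C.support`), and `Keep = {v | some walk v → b of Ω_δ avoids K}`.  Then some closed lattice walk
`C'` through all of `C.support` and all of `K` PRESENTS the hung carrier: `(dom C' δ)_δ` is `Ω_δ`
restricted to `Keep`.

* If the target `b` is a non-isolated vertex of `Ω_δ` this is the landed sibling helper
  `GatesByBubbleDoorsByFKG.necklace_hungPresentation` (file `…NecklaceHung`), with `C' : c → c`.
* If `b` is isolated in `Ω_δ`, a walk of `Ω_δ` into `b` is trivial, so `Keep ⊆ {b}` carries no edge
  and the hung carrier is EMPTY: we sweep `K` together with ALL mesh vertices of `Ω` onto the trace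
  (`emptyPresentation_one`, by the landed sweep lemma `ExcursionDomination.stub_sweep`, p100023);
  the swept walk has the same index off its (larger) trace, so it has no mesh vertex at all, hence
  its discrete domain has no edge.  Mesh `δ` is reduced to mesh `1` along
  `CornerLoc.discreteDomainGraph_dom`.

Only theorems; no named fact; axioms are the standard three.
-/

noncomputable section

open Set
open Literature.Probability.LatticeModels Literature.Probability.RandomPlanarGeometry
open Literature.Topology.PlaneTopology
open Summit.CriticalPhenomena.SAWScalingLimit.Theorems.FKGToTraversalBound.Negative (dom)
open Summit.CriticalPhenomena.SAWScalingLimit.Theorems.FKGToTraversalBound.ExcursionDomination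
  (notMem_range_of_mem_dom segment_subset_dom_one stub_sweep)
open Summit.CriticalPhenomena.SAWScalingLimit.Theorems.LeftRightFKG.Negative (pt meshPoint_one)
open Summit.CriticalPhenomena.SAWScalingLimit.Theorems.LeftRightFKG.CornerLoc
  (isBounded_dom discreteDomainGraph_dom)

namespace Summit.CriticalPhenomena.SAWScalingLimit.Theorems.FKGToTraversalBound.SlitNecklace

/-! ### The empty presentation at mesh `1` -/

/-- **Empty presentation at mesh `1`.**  For a closed lattice walk `C : c → c` and a finite ATTACHED
set `K` (every `k ∈ K` joined to a vertex of `C` by a lattice walk through `K ∪ C.support`), some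
closed walk `C' : c → c` through `C.support ∪ K` has NO mesh vertex at mesh `1`: sweep `K` and all
mesh vertices of `dom C 1` onto the trace (a mesh vertex walks east through mesh vertices until it
meets the trace). [folklore] -/
theorem emptyPresentation_one {c : Site 2} (C : (zdGraph 2).Walk c c) (K : Finset (Site 2))
    (hK : ∀ k ∈ K, ∃ (q : Site 2) (p : (zdGraph 2).Walk k q), q ∈ C.support ∧
      ∀ x ∈ p.support, x ∈ K ∨ x ∈ C.support) :
    ∃ C' : (zdGraph 2).Walk c c, (∀ x ∈ C.support, x ∈ C'.support) ∧ (∀ k ∈ K, k ∈ C'.support) ∧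
      ∀ x : Site 2, x ∉ meshVertices (dom C' 1) 1 := by
  classical
  -- the sweep set `S = K ∪ meshVertices`
  have hbdd : Bornology.IsBounded (dom C 1) := isBounded_dom C 1
  have hVfin : (meshVertices (dom C 1) 1).Finite := meshVertices_finite hbdd one_pos
  set S : Finset (Site 2) := K ∪ hVfin.toFinset with hSdef
  have hSmem : ∀ k, k ∈ S ↔ k ∈ K ∨ k ∈ meshVertices (dom C 1) 1 := fun k => by
    rw [hSdef, Finset.mem_union, Set.Finite.mem_toFinset]
  have hKS : ∀ k ∈ K, k ∈ S := fun k hk => (hSmem k).2 (Or.inl hk)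
  -- attachment of the `K`-part (by hypothesis)
  have hattK : ∀ k ∈ K, ∃ (q : Site 2) (p : (zdGraph 2).Walk k q), q ∈ C.support ∧
      ∀ x ∈ p.support, x ∈ S ∨ x ∈ C.support := by
    intro k hk
    obtain ⟨q, p, hq, hp⟩ := hK k hk
    exact ⟨q, p, hq, fun x hx => (hp x hx).imp_left (hKS x)⟩
  -- attachment of the mesh part: walk east
  obtain ⟨M, hM⟩ := (hVfin.image fun x : Site 2 => x 0).bddAbove
  have hM' : ∀ x ∈ meshVertices (dom C 1) 1, x 0 ≤ M := fun x hx => hM (Set.mem_image_of_mem _ hx)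
  set e₀ : Site 2 := Pi.single 0 1 with he₀
  have hadjE : ∀ k : Site 2, (zdGraph 2).Adj k (k + e₀) :=
    fun k => (zdGraph_adj_iff _ _).2 ⟨0, Or.inl rfl⟩
  have he0 : ∀ k : Site 2, (k + e₀) 0 = k 0 + 1 := fun k => by simp [he₀]
  -- the east neighbour of a mesh vertex off the trace is a mesh vertex
  have hE : ∀ k : Site 2, k ∈ meshVertices (dom C 1) 1 → k + e₀ ∉ C.support →
      k + e₀ ∈ meshVertices (dom C 1) 1 := by
    intro k hkV hk'C
    rw [mem_meshVertices_iff, meshPoint_one] at hkV ⊢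
    exact segment_subset_dom_one C (hadjE k) hkV hk'C (right_mem_segment _ _ _)
  -- prepending the east step to an attaching walk
  have hcons : ∀ (k q : Site 2) (p : (zdGraph 2).Walk (k + e₀) q), k ∈ S → q ∈ C.support →
      (∀ x ∈ p.support, x ∈ S ∨ x ∈ C.support) →
      ∃ (q : Site 2) (p : (zdGraph 2).Walk k q), q ∈ C.support ∧
        ∀ x ∈ p.support, x ∈ S ∨ x ∈ C.support := by
    intro k q p hkS hqC hp
    refine ⟨q, SimpleGraph.Walk.cons (hadjE k) p, hqC, fun x hx => ?_⟩
    rw [SimpleGraph.Walk.support_cons, List.mem_cons] at hx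
    rcases hx with rfl | hx
    · exact Or.inl hkS
    · exact hp x hx
  have hdone : ∀ k : Site 2, k ∈ S → k + e₀ ∈ C.support →
      ∃ (q : Site 2) (p : (zdGraph 2).Walk k q), q ∈ C.support ∧
        ∀ x ∈ p.support, x ∈ S ∨ x ∈ C.support := by
    intro k hkS hk'C
    refine hcons k (k + e₀) SimpleGraph.Walk.nil hkS hk'C fun x hx => ?_
    rw [SimpleGraph.Walk.support_nil, List.mem_singleton] at hx
    subst hx
    exact Or.inr hk'C
  have key : ∀ n : ℕ, ∀ k : Site 2, k ∈ meshVertices (dom C 1) 1 → M - k 0 ≤ n →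
      ∃ (q : Site 2) (p : (zdGraph 2).Walk k q), q ∈ C.support ∧
        ∀ x ∈ p.support, x ∈ S ∨ x ∈ C.support := by
    intro n
    induction n with
    | zero =>
      intro k hkV hn
      by_cases hk'C : k + e₀ ∈ C.support
      · exact hdone k ((hSmem k).2 (Or.inr hkV)) hk'C
      · exfalso
        have h1 := hM' _ (hE k hkV hk'C)
        rw [he0] at h1; push_cast at hn; omega
    | succ n ih =>
      intro k hkV hn
      by_cases hk'C : k + e₀ ∈ C.support
      · exact hdone k ((hSmem k).2 (Or.inr hkV)) hk'C
      · obtain ⟨q, p, hqC, hp⟩ := ih _ (hE k hkV hk'C) (by rw [he0]; push_cast at hn ⊢; omega)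
        exact hcons k q p ((hSmem k).2 (Or.inr hkV)) hqC hp
  have hattS : ∀ k ∈ S, ∃ (q : Site 2) (p : (zdGraph 2).Walk k q), q ∈ C.support ∧
      ∀ x ∈ p.support, x ∈ S ∨ x ∈ C.support := by
    intro k hk
    rcases (hSmem k).1 hk with hkK | hkV
    · exact hattK k hkK
    · exact key (M - k 0).toNat k hkV (Int.self_le_toNat _)
  -- sweep
  obtain ⟨C', hC'supp, hC'wind⟩ := stub_sweep c C S hattS
  refine ⟨C', fun x hx => (hC'supp x).2 (Or.inl hx), fun k hk => (hC'supp k).2 (Or.inr (hKS k hk)),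
    fun x hx => ?_⟩
  -- a mesh vertex of the swept walk would be an old one (same index off the new trace), hence swept
  rw [mem_meshVertices_iff, meshPoint_one] at hx
  have hxT' : pt x ∉ Set.range (C'.toCurve (meshPoint 1)) := notMem_range_of_mem_dom C' 1 hx
  obtain ⟨-, hw⟩ := hC'wind 1 (pt x) one_pos hxT'
  have hxV : x ∈ meshVertices (dom C 1) 1 := by
    rw [mem_meshVertices_iff, meshPoint_one]; change wind _ ≠ 0; rw [← hw]; exact hx
  have hxC' : x ∉ C'.support := fun h =>
    hxT' (by simpa only [meshPoint_one] using C'.mem_range_toCurve (meshPoint 1) h)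
  exact hxC' ((hC'supp x).2 (Or.inr ((hSmem x).2 (Or.inr hxV))))

/-! ### The registered stub (any mesh, any target) -/

/-- **Registered stub `stub_hungPresentation`** (crux stmt-CriticalPhenomena-1878, line `slit-necklace`,
STUB 2): **every hung carrier is r2.**  For a closed lattice walk `C`, mesh `δ > 0`, a target `b` and a
finite set `K ∌ b` of sites ATTACHED to `C` (each joined to a vertex of `C` through `K ∪ C.support`),
some closed lattice walk `C'` through all of `C.support` and all of `K` presents the hung carrier:
`(dom C' δ)_δ` is `Ω_δ = (dom C δ)_δ` restricted to `Keep(b, K) = {v | some walk v → b of Ω_δ avoids K}`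
(graph equality).  Non-isolated `b`: the landed `GatesByBubbleDoorsByFKG.necklace_hungPresentation`;
isolated `b`: `Keep ⊆ {b}` carries no edge and the empty carrier is presented by
`emptyPresentation_one`, transported to mesh `δ` along `CornerLoc.discreteDomainGraph_dom`.
[folklore] -/
theorem stub_hungPresentation : ∀ (δ : ℝ) (c b : Site 2) (C : (zdGraph 2).Walk c c) (K : Finset (Site 2)), 0 < δ → b ∉ K → (∀ k ∈ K, ∃ (q : Site 2) (p : (zdGraph 2).Walk k q), q ∈ C.support ∧ ∀ x ∈ p.support, x ∈ K ∨ x ∈ C.support) → ∃ (c' : Site 2) (C' : (zdGraph 2).Walk c' c'), (∀ x ∈ C.support, x ∈ C'.support) ∧ (∀ k ∈ K, k ∈ C'.support) ∧ ∀ x y : Site 2, (discreteDomainGraph (dom C' δ) δ).Adj x y ↔ ((discreteDomainGraph (dom C δ) δ).Adj x y ∧ (∃ q : (discreteDomainGraph (dom C δ) δ).Walk x b, ∀ v ∈ q.support, v ∉ K) ∧ (∃ q : (discreteDomainGraph (dom C δ) δ).Walk y b, ∀ v ∈ q.support, v ∉ K)) := by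
  intro δ c b C K hδ hbK hK
  by_cases hb : ∃ w : Site 2, (discreteDomainGraph (dom C δ) δ).Adj b w
  · -- non-isolated target: the landed sibling helper
    obtain ⟨C', h1, h2, h3⟩ := GatesByBubbleDoorsByFKG.necklace_hungPresentation δ c b C K hδ hbK hb hK
    exact ⟨c, C', h1, h2, h3⟩
  · -- isolated target: both sides of the equivalence are `False`
    obtain ⟨C', h1, h2, h3⟩ := emptyPresentation_one C K hK
    refine ⟨c, C', h1, h2, fun x y => ?_⟩
    -- a walk of `Ω_δ` out of the isolated `b` is trivial
    have htriv : ∀ (z : Site 2) (q : (discreteDomainGraph (dom C δ) δ).Walk b z), z = b := by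
      intro z q
      cases q with
      | nil => rfl
      | cons h _ => exact absurd ⟨_, h⟩ hb
    constructor
    · intro hxy
      rw [show discreteDomainGraph (dom C' δ) δ = discreteDomainGraph (dom C' 1) 1 from
        discreteDomainGraph_dom C' hδ.ne'] at hxy
      exact absurd (meshDomain_subset_meshVertices _ _ (discreteDomainGraph_adj_iff.1 hxy).2.1) (h3 x)
    · rintro ⟨hxy, ⟨qx, -⟩, ⟨qy, -⟩⟩
      obtain rfl := htriv x qx.reverse
      obtain rfl := htriv y qy.reverse
      exact (hxy.ne rfl).elim

end Summit.CriticalPhenomena.SAWScalingLimit.Theorems.FKGToTraversalBound.SlitNecklace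

end
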